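import Summits.QuantumAdvantage.AdviceFreeQNC0.WalkEliminationModule
import HarnessLib

/-!
# Cell qa-qnc0 (rung F-Q1, route RingFrame, crux α `RingToElim`): the RING EXACT LAW as an exact
# threshold — a perfect walk strategy with the ring charge exists iff `n ≤ 2D + 1`
# (planner qa-qnc0-p1 TARGET §15.3 `RingExactLawU`, all `n`, all `D`)

The lower half is in the tree (phase law `ringWinU_exists_fail_ring` at `n = 2D+2`, fail floor
`ringWinU_fail_floor` above; prover qn-prover-3 gen 5/6).  This file proves the upper half —
PERFECT RING PLAY EXISTS for `n ≤ 2D+1` at every charge `c ≢ n (mod 3)`, in particular at the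
ring's own charge `n + 2` — by an ELIMINATOR (only the two end cuts bet):

(`WalkEliminationModule.lean`: the `𝔽₂`-basis `{ω^c, ω^{2c+2n}}` of `𝔽₄` for `c ≢ n (mod 3)` and
`polySpan_decomp`; the reconstruction `exists_chiSpan_tr_eq` for the balls of radius `D` around
`1ⁿ` and `2ⁿ`, which cover `{1,2}ⁿ` in conjugate pairs exactly when `n ≤ 2D+1`; the elimination
module `chiSpan_ball_le`.)  Over it:

* **`exists_perfect_ringWinU`** — for `n ≤ 2D+1` and `c ≢ n (mod 3)` a walk strategy of
  `𝔽₂`-degree `≤ D` with charge `c`, supported on the cuts `g = 0` and `g = n`, wins on EVERY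
  input: write the perfect element `F·χ_{1^n}` of the elimination module as
  `A ω^c χ_{1^n} + B ω^{2c+2n} χ_{1^n}` and use `tr(z) = tr(z²)`, `(Bω^{2c+2n}χ_{1^n})² =
  B ω^{c+n} χ_{2^n}` — the bets `y₀ = A`, `y_n = B`;
* **`ringWinU_perfect_iff_ring`** — THE RING EXACT LAW: a perfect walk strategy of degree `≤ D`
  with the ring charge `n+2` exists iff `n ≤ 2D+1` (i.e. `D ≥ ⌊n/2⌋`; on the `N`-cycle, `N = n+1`:
  the transposition-class game is exactly solvable at degree `D` iff `D ≥ ⌊(N−1)/2⌋`).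

The cell's theorem (planner qa-qnc0-p1 gen 3: "RING EXACT LAW ⌊n/2⌋, all n" with the converse
"observed, not claimed"; prover qn-prover-3 gen 6 kernel proof of both halves), 2026-08-27; not
in print.  WHAT THIS IS NOT: the easy-charge converse at `n = 2D+2` (`c ≡ −(D+1)`) is not
constructed; exact-law statements only, nothing at constant `η`; no separation claim.
-/

noncomputable section

namespace Summit.QuantumAdvantage.AdviceFreeQNC0

open Finset
open Literature.Computability.MetaComplexity Literature.Computability.MetaComplexity.Smolensky
open F4

variable {n : ℕ}

/-- The two elements of `𝔽₂`. -/
private theorem zmod2_cases' (s : ZMod 2) : s = 0 ∨ s = 1 := by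
  fin_cases s
  · exact Or.inl rfl
  · exact Or.inr rfl


/-- `conj 1^n = 2^n`. -/
private theorem conj_aPat_zero : conj (aPat (m := n) 0) = aPat n := by
  funext i
  simp [conj, aPat, i.isLt]

/-- **PERFECT RING PLAY EXISTS for `n ≤ 2D+1`, `c ≢ n (mod 3)`**: an eliminator (bets only at the
cuts `g = 0` and `g = n`) of `𝔽₂`-degree `≤ D` wins the walk game with charge `c` on every input.
[folklore] -/
theorem exists_perfect_ringWinU (D c : ℕ) (hn : n ≤ 2 * D + 1) (hc : (c + 2 * n) % 3 ≠ 0) :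
    ∃ y : Fin (n + 1) → (Fin n → Bool) → Bool, (∀ g, HasDeg (y g) D) ∧ ∀ u, ringWinU c y u = true := by
  classical
  haveI := F4.nontrivial
  -- Step A: a perfect element of the elimination module
  have hcover : ∀ a : Fin n → Bool, ¬ pdist a (aPat 0) ≤ D → ¬ pdist (conj a) (aPat 0) ≤ D →
      Lfun a (fun _ => (1 : F4)) = 0 := by
    intro a ha ha'
    exfalso
    have hsum : pdist a (aPat 0) + pdist (conj a) (aPat 0) = n := by
      unfold pdist
      have e1 : (univ.filter fun i : Fin n => a i ≠ aPat 0 i) = univ.filter fun i : Fin n => a i = true :=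
        Finset.filter_congr fun i _ => by simp [aPat]
      have e2 : (univ.filter fun i : Fin n => conj a i ≠ aPat 0 i) =
          univ.filter fun i : Fin n => ¬ a i = true :=
        Finset.filter_congr fun i _ => by simp [aPat, conj]
      rw [e1, e2, Finset.card_filter_add_card_filter_not, Finset.card_univ, Fintype.card_fin]
    omega
  obtain ⟨f, hf, htr⟩ := exists_chiSpan_tr_eq (fun a : Fin n → Bool => pdist a (aPat 0) ≤ D)
    (fun _ => (1 : F4)) (fun _ => by rw [one_pow]) hcover
  -- Step B: `f = F · χ_{1^n}` with `F ∈ 𝔽₄[u]_{≤D}`; decompose `F = A ω^c + B ω^{2c+2n}`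
  obtain ⟨F, hF, hfF⟩ := Submodule.mem_map.1 (chiSpan_ball_le n D hf)
  have hcc : c % 3 ≠ (2 * c + 2 * n) % 3 := by omega
  obtain ⟨A, B, hA, hB, hFAB⟩ := polySpan_decomp hcc hF
  -- Step C: the eliminator
  rcases Nat.eq_zero_or_pos n with hn0 | hnpos
  · -- no bits: the single input; bet at the (only) cut iff it wins, i.e. `c % 3 ≠ 0`
    subst hn0
    refine ⟨fun _ _ => true, fun g => ?_, fun u => ?_⟩
    · unfold HasDeg
      have e : (fun x : Fin 0 → Bool => if true = true then (1 : ZMod 2) else 0) = mono (ZMod 2) ∅ := by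
        funext x; simp [mono]
      rw [e]; exact mono_mem_lowDeg (by simp)
    · have hc0 : c % 3 ≠ 0 := by simpa using hc
      unfold ringWinU
      rw [decide_eq_true_eq]
      have hset : (univ.filter fun g : Fin (0 + 1) =>
          true = true ∧ (c + g.val + walkExp u g.val) % 3 ≠ 0) = univ := by
        refine Finset.filter_true_of_mem fun g _ => ⟨rfl, ?_⟩
        have hg : g.val = 0 := by omega
        have hw : walkExp u g.val = 0 := by
          unfold walkExp wt wtPrefix
          simp
        rw [hw, hg]
        simpa using hc0
      rw [hset]
      simp
  · set y : Fin (n + 1) → (Fin n → Bool) → Bool := fun g u =>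
      if g.val = 0 then decide (A u = 1) else if g.val = n then decide (B u = 1) else false with hy
    have hbit : ∀ s : ZMod 2, ιF (decide (s = 1)) = algebraMap (ZMod 2) F4 s := by
      intro s
      rcases zmod2_cases' s with h | h <;> rw [h] <;> simp [ιF]
    have hind : ∀ s : ZMod 2, (if decide (s = 1) = true then (1 : ZMod 2) else 0) = s := by
      intro s
      rcases zmod2_cases' s with h | h <;> rw [h] <;> simp
    have hyv : ∀ (g : Fin (n + 1)) (x : Fin n → Bool),
        y g x = (if g.val = 0 then decide (A x = 1) else if g.val = n then decide (B x = 1) else false) :=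
      fun g x => rfl
    refine ⟨y, fun g => ?_, fun u => ?_⟩
    · -- degrees
      unfold HasDeg
      by_cases h0 : g.val = 0
      · have e : (fun x => if y g x = true then (1 : ZMod 2) else 0) = A := by
          funext x
          rw [hyv g x, if_pos h0, hind]
        rw [e]; exact hA
      · by_cases hn' : g.val = n
        · have e : (fun x => if y g x = true then (1 : ZMod 2) else 0) = B := by
            funext x
            rw [hyv g x, if_neg h0, if_pos hn', hind]
          rw [e]; exact hB
        · have e : (fun x => if y g x = true then (1 : ZMod 2) else 0) = 0 := by
            funext x
            rw [hyv g x, if_neg h0, if_neg hn']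
            simp
          rw [e]; exact Submodule.zero_mem _
    · -- perfection: `tr (stratFun) = tr (F χ₀) = 1`
      have hstrat : stratFun c y u =
          algebraMap (ZMod 2) F4 (A u) * ω ^ c * chi (aPat 0) u +
            algebraMap (ZMod 2) F4 (B u) * ω ^ (c + n) * chi (aPat n) u := by
        rw [stratFun_eq]
        dsimp only
        have h0n : (⟨0, by omega⟩ : Fin (n + 1)) ≠ ⟨n, by omega⟩ := by
          intro h; have := congrArg Fin.val h; simp at this; omega
        rw [← Finset.sum_erase_add _ _ (Finset.mem_univ (⟨0, by omega⟩ : Fin (n + 1))),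
          ← Finset.sum_erase_add _ _ (Finset.mem_erase.2 ⟨h0n.symm, Finset.mem_univ _⟩)]
        have hrest : ∑ g ∈ ((univ.erase (⟨0, by omega⟩ : Fin (n + 1))).erase ⟨n, by omega⟩),
            ω ^ (c + g.val) * (ιF (y g u) * chi (aPat g.val) u) = 0 := by
          refine Finset.sum_eq_zero fun g hg => ?_
          have hg1 := Finset.mem_erase.1 hg
          have hg2 := Finset.mem_erase.1 hg1.2
          have hgn : g.val ≠ n := fun h => hg1.1 (Fin.ext h)
          have hg0 : g.val ≠ 0 := fun h => hg2.1 (Fin.ext h)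
          rw [hyv g u, if_neg hg0, if_neg hgn]
          simp [ιF]
        rw [hrest, zero_add, hyv, hyv]
        simp only [if_true, show (n : ℕ) ≠ 0 by omega, if_false, hbit]
        ring
      have hsq : (algebraMap (ZMod 2) F4 (B u) * ω ^ (2 * c + 2 * n) * chi (aPat 0) u) ^ 2 =
          algebraMap (ZMod 2) F4 (B u) * ω ^ (c + n) * chi (aPat n) u := by
        rw [mul_pow, mul_pow, chi_sq, conj_aPat_zero, ← map_pow, ← pow_mul,
          show B u ^ 2 = B u from by
            rcases zmod2_cases' (B u) with h | h <;> rw [h] <;> rfl,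
          omega_pow_mod ((2 * c + 2 * n) * 2), omega_pow_mod (c + n),
          show (2 * c + 2 * n) * 2 % 3 = (c + n) % 3 by omega]
      have htrsq : ∀ z : F4, tr (z ^ 2) = tr z := fun z => by
        unfold tr; rw [← pow_mul, show 2 * 2 = 4 from rfl, F4.pow_four, add_comm]
      have key : tr (stratFun c y u) = tr (f u) := by
        rw [hstrat, tr_add, ← hsq, htrsq, ← tr_add, ← hfF, LinearMap.mulRight_apply, hFAB]
        congr 1
        simp only [Pi.mul_apply]
        ring
      have h1 : ιF (ringWinU c y u) = 1 := by rw [← tr_stratFun, key, htr u]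
      revert h1
      unfold ιF
      cases ringWinU c y u <;> simp

/-- **THE RING EXACT LAW as an exact threshold** (TARGET §15.3 `RingExactLawU`, all `n, D`): a
walk strategy of `𝔽₂`-degree `≤ D` with the ring charge `n+2` that wins on EVERY input exists iff
`n ≤ 2D + 1`. [folklore] -/
theorem ringWinU_perfect_iff_ring {D : ℕ} :
    (∃ y : Fin (n + 1) → (Fin n → Bool) → Bool, (∀ g, HasDeg (y g) D) ∧ ∀ u, ringWinU (n + 2) y u = true) ↔
      n ≤ 2 * D + 1 := by
  constructor
  · rintro ⟨y, hy, hwin⟩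
    by_contra h
    rw [not_le] at h
    by_cases heq : n = 2 * D + 2
    · subst heq
      obtain ⟨u, hu⟩ := ringWinU_exists_fail_ring D y hy
      rw [hwin u] at hu
      exact Bool.noConfusion hu
    · have h3 : 2 * D + 3 ≤ n := by omega
      have hfl := ringWinU_fail_floor D h3 (n + 2) y hy
      have hpos : 0 < (univ.filter fun u : Fin n → Bool => ringWinU (n + 2) y u = false).card :=
        lt_of_lt_of_le (Nat.two_pow_pos _) hfl
      obtain ⟨u, hu⟩ := Finset.card_pos.1 hpos
      have := (Finset.mem_filter.1 hu).2
      rw [hwin u] at this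
      exact Bool.noConfusion this
  · intro hn
    exact exists_perfect_ringWinU D (n + 2) hn (by omega)

end Summit.QuantumAdvantage.AdviceFreeQNC0

end
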